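import Mathlib
import Summits.ValiantsHypothesis.ValiantsHypothesis.Theses.LacunarySymmetroid
import Literature.Computability.AlgebraicComplexity.CommutativeExtensionSimulation
import Literature.Computability.AlgebraicComplexity.VPDeterminantalQPProofs
import Summits.ValiantsHypothesis.ValiantsHypothesis.Theorems.SymmetroidDescartesThetaPencilWitnessPencil
import Summits.ValiantsHypothesis.ValiantsHypothesis.Theorems.ElementaryWordLengthWordLengthQPIffEVH

/-!
# Route LacunarySymmetroid — crux `PencilTransfer` (stmt-ValiantsHypothesis-18051): PROOF

`pencilTransfer_proof : Summit.ValiantsHypothesis.ValiantsHypothesis.Theses.LacunarySymmetroid.PencilTransfer`.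

Line `real-descent-exact` of the crux chain ("descend, don't realify"; card
`Cruxes/PencilTransfer/Ideas/real-descent-exact.md`, complete candidate by the round-1 crux ideator,
landed by the line lead):

* `pencilTransfer_lmap_reLm_map`, `pencilTransfer_complexity_real_le`: `re` applied coefficientwise to
  `f ⊗ ℂ` is `f`, hence `L_ℝ(f) ≤ 68 · L_ℂ(f ⊗ ℂ) + 6` (Hrubeš–Yehudayoff 2011, Thm 4.2 for the basis
  `{1, i}` of `ℂ/ℝ`: tree `CommExtSim.complexity_lmap_le`).
* `isVPFamily_real_of_complex`: DESCENT OF THE HYPOTHESIS — a real family whose complexification is `VP`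
  over `ℂ` is `VP` over `ℝ` (degree by `support_map_of_injective`, size by the above).
* `symmAffineRepr_of_isVPFamily_complex` (the d-free transfer): `dc_ℝ(f_n)` is quasi-polynomially
  bounded (`isQPBounded_determinantalComplexity_of_isVPFamily_holds` at `k := ℝ`, attained by
  `hasDetRepr_determinantalComplexity_holds`) and `f_n = det B_n` for a SYMMETRIC affine real matrix of size
  `4 dc³ + 7` (Grenet–Kaltofen–Koiran–Portier 2011 Thm 5 over `ℝ`: tree
  `SymmetroidDescartes.hasSymmAffineDetRepr_of_hasDetRepr` / `GKKP2011_detPoly_symmetric_holds`).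
* `pencilDet_of_affine`: restriction of an affine matrix to the monomial curve `y_i := X^{e_i}` is the
  lacunary pencil with coefficient matrices `Fin.cons (constPart B) (coeffMat B ·)` and the LITERAL exponents
  `Fin.cons 0 e`, as a polynomial identity (`LRPencil.eq_affine_of_totalDegree_le_one`, `AlgHom.map_det`);
  `pencilTransfer_pointwise`: hence the root finsets agree (the determinant IS `f_n(X^{d})`, no squaring).
* `pencilTransfer_size_bound`: `dc ≤ 2^{(ℓ+c)^c} ⟹ 4 dc³ + 7 ≤ 2^{(ℓ + (c+11))^{c+11}}`
  (exponent step reused from the tree's `EpsOrderLadder.exp_bound_word_to_vqp`);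
  `pencilTransfer_proof`: assembly.

References: [HrubesYehudayoff2011] Thm 4.2; [GrenetEtAl2011] Thm 5; [Valiant1979] Thm 1;
[Burgisser2000] Cor 2.28, Prop 2.30; [MignonRessayre2004] §1.
-/

-- single-conjunct layout: Sub = Summit, duplicated namespace component intended
set_option linter.dupNamespace false

noncomputable section

namespace Summit.ValiantsHypothesis.ValiantsHypothesis.Theorems.LacunarySymmetroid

open MvPolynomial Literature.Computability.AlgebraicComplexity

/-- `re` applied coefficientwise to the complexification of a real polynomial gives it back. -/
theorem pencilTransfer_lmap_reLm_map (σ : Type*) (f : MvPolynomial σ ℝ) :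
    CommExtSim.lmap Complex.reLm (MvPolynomial.map (algebraMap ℝ ℂ) f) = f := by
  ext m
  rw [CommExtSim.coeff_lmap, MvPolynomial.coeff_map]
  simp

/-- Realification of complexity for a real polynomial (Hrubeš–Yehudayoff Thm 4.2, `d = 2`):
`L_ℝ(f) ≤ 68 · L_ℂ(f ⊗ ℂ) + 6`. -/
theorem pencilTransfer_complexity_real_le {σ : Type*} [Fintype σ] (f : MvPolynomial σ ℝ) :
    complexity f ≤ 68 * complexity (MvPolynomial.map (algebraMap ℝ ℂ) f) + 6 := by
  have h := CommExtSim.complexity_lmap_le (σ := σ) Complex.basisOneI Complex.reLm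
    (MvPolynomial.map (algebraMap ℝ ℂ) f)
  rw [pencilTransfer_lmap_reLm_map] at h
  simpa using h

/-- **Descent of the hypothesis**: `IsVPFamily (f ⊗ ℂ) → IsVPFamily f`. -/
theorem isVPFamily_real_of_complex (v : ℕ → ℕ) (f : ∀ n, MvPolynomial (Fin (v n)) ℝ)
    (h : IsVPFamily (fun n => MvPolynomial.map (algebraMap ℝ ℂ) (f n))) : IsVPFamily f := by
  obtain ⟨⟨hvar, hdeg⟩, hL⟩ := h
  refine ⟨⟨hvar, hdeg.mono fun n => le_of_eq ?_⟩, ?_⟩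
  · -- total degree is invariant under the injective base change
    simp only [MvPolynomial.totalDegree,
      MvPolynomial.support_map_of_injective _ (algebraMap ℝ ℂ).injective]
  · -- complexity: `68 · L_ℂ + 6` is p-bounded
    have h68 : IsPBounded fun n => 68 * complexity (MvPolynomial.map (algebraMap ℝ ℂ) (f n)) + 6 :=
      IsPBounded.add_holds (IsPBounded.mul_holds ⟨68, fun n => Nat.le_add_left 68 _⟩ hL)
        ⟨6, fun n => Nat.le_add_left 6 _⟩
    exact h68.mono fun n => pencilTransfer_complexity_real_le (f n)

/-- **The d-free transfer C⁺, modulo exponent bookkeeping**: a symmetric affine real representation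
of quasi-polynomial size `4·dc_ℝ(f_n)³ + 7`, with `dc_ℝ` quasi-polynomially bounded. -/
theorem symmAffineRepr_of_isVPFamily_complex (v : ℕ → ℕ) (f : ∀ n, MvPolynomial (Fin (v n)) ℝ)
    (h : IsVPFamily (fun n => MvPolynomial.map (algebraMap ℝ ℂ) (f n))) :
    IsQPBounded (fun n => determinantalComplexity (f n)) ∧
    ∀ n, ∃ B : Matrix (Fin (4 * determinantalComplexity (f n) ^ 3 + 7))
        (Fin (4 * determinantalComplexity (f n) ^ 3 + 7)) (MvPolynomial (Fin (v n)) ℝ),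
      B.IsSymm ∧ IsAffineDetRepr (f n) B := by
  have hVP := isVPFamily_real_of_complex v f h
  refine ⟨isQPBounded_determinantalComplexity_of_isVPFamily_holds f hVP, fun n => ?_⟩
  exact Summit.ValiantsHypothesis.ValiantsHypothesis.Theorems.SymmetroidDescartes.hasSymmAffineDetRepr_of_hasDetRepr
    (k := ℝ) two_ne_zero (hasDetRepr_determinantalComplexity_holds (f n))

/-- **Pencil identity with literal exponents** (`PencilDetOfSymmAffine` of the sketch): restricting an
affine matrix `B` to the monomial curve `y_i := X^{e_i}` gives the lacunary pencil with coefficient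
matrices `Fin.cons (constPart B) (coeffMat B ·)` and exponents `Fin.cons 0 e`, as a POLYNOMIAL identity. -/
theorem pencilDet_of_affine {v m : ℕ} (B : Matrix (Fin m) (Fin m) (MvPolynomial (Fin v) ℝ))
    (hB : ∀ a b, (B a b).totalDegree ≤ 1) (e : Fin v → ℕ) :
    (∑ l, (Polynomial.X : Polynomial ℝ) ^ (Fin.cons (α := fun _ => ℕ) (0 : ℕ) e l) •
        ((Fin.cons (α := fun _ => Matrix (Fin m) (Fin m) ℝ) (constPart B)
          (fun i => LRPencil.coeffMat B i) l).map Polynomial.C)).det =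
      MvPolynomial.aeval (fun i => (Polynomial.X : Polynomial ℝ) ^ e i) B.det := by
  set φ : MvPolynomial (Fin v) ℝ →ₐ[ℝ] Polynomial ℝ := MvPolynomial.aeval fun i => Polynomial.X ^ e i
    with hφ
  have hmat : (∑ l, (Polynomial.X : Polynomial ℝ) ^ (Fin.cons (α := fun _ => ℕ) (0 : ℕ) e l) •
        ((Fin.cons (α := fun _ => Matrix (Fin m) (Fin m) ℝ) (constPart B)
          (fun i => LRPencil.coeffMat B i) l).map Polynomial.C)) = φ.mapMatrix B := by
    refine Matrix.ext fun a c => ?_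
    simp only [Matrix.sum_apply, Matrix.smul_apply, Matrix.map_apply, Fin.sum_univ_succ,
      Fin.cons_zero, Fin.cons_succ, pow_zero, constPart_apply, LRPencil.coeffMat_apply,
      smul_eq_mul, AlgHom.mapMatrix_apply, one_mul]
    conv_rhs => rw [LRPencil.eq_affine_of_totalDegree_le_one (B a c) (hB a c)]
    simp only [map_add, map_sum, map_mul, hφ, MvPolynomial.aeval_C, MvPolynomial.aeval_X,
      Polynomial.algebraMap_apply, Algebra.algebraMap_self, RingHom.id_apply,
      MvPolynomial.constantCoeff_eq]
    congr 1
    exact Finset.sum_congr rfl fun i _ => mul_comm _ _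
  rw [hmat, ← AlgHom.map_det]

/-- Root-finset currency: the crux's conclusion for ONE `n`, from a symmetric affine representation. -/
theorem pencilTransfer_pointwise {v m : ℕ} (f : MvPolynomial (Fin v) ℝ)
    (B : Matrix (Fin m) (Fin m) (MvPolynomial (Fin v) ℝ)) (hsymm : B.IsSymm)
    (hB : IsAffineDetRepr f B) (d : Fin v → ℕ) :
    ∃ S : Fin (v + 1) → Matrix (Fin m) (Fin m) ℝ, (∀ l, (S l).IsSymm) ∧
      (Matrix.det (∑ l, ((Polynomial.X : Polynomial ℝ) ^ (Fin.cons (α := fun _ => ℕ) (0 : ℕ) d l)) •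
        (S l).map Polynomial.C)).roots.toFinset =
      (MvPolynomial.aeval (fun i => (Polynomial.X : Polynomial ℝ) ^ d i) f).roots.toFinset := by
  refine ⟨Fin.cons (constPart B) (fun i => LRPencil.coeffMat B i), ?_, ?_⟩
  · refine Fin.cases ?_ (fun i => ?_)
    · rw [Fin.cons_zero]; exact hsymm.map _
    · rw [Fin.cons_succ]; exact hsymm.map _
  · rw [pencilDet_of_affine B hB.1 d, hB.2]

/-- Size bookkeeping: `dc ≤ 2^e`, `e = (ℓ + c)^c` ⟹ `4 dc³ + 7 ≤ 2^{(ℓ + (c+11))^{c+11}}`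
(the exponent step `3e + 8 ≤ (ℓ + (c+11))^{c+11}` is the tree's `EpsOrderLadder.exp_bound_word_to_vqp`). -/
theorem pencilTransfer_size_bound {dc ℓ c : ℕ} (hdc : dc ≤ 2 ^ ((ℓ + c) ^ c)) :
    4 * dc ^ 3 + 7 ≤ 2 ^ ((ℓ + (c + 11)) ^ (c + 11)) := by
  set e := (ℓ + c) ^ c with he_def
  have he : 1 ≤ e := Summit.ValiantsHypothesis.Theorems.DetqpThesis.Negative.one_le_qpExp ℓ c
  have hx : 8 ≤ 2 ^ (3 * e) := by
    calc (8 : ℕ) = 2 ^ 3 := by norm_num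
      _ ≤ 2 ^ (3 * e) := Nat.pow_le_pow_right (by norm_num) (by omega)
  have h1 : dc ^ 3 ≤ 2 ^ (3 * e) := by
    calc dc ^ 3 ≤ (2 ^ e) ^ 3 := Nat.pow_le_pow_left hdc 3
      _ = 2 ^ (3 * e) := by rw [← pow_mul, mul_comm]
  have h2 : 4 * dc ^ 3 + 7 ≤ 2 ^ (3 * e + 3) := by
    have : 2 ^ (3 * e + 3) = 2 ^ (3 * e) * 8 := by rw [pow_add]; norm_num
    rw [this]
    omega
  exact h2.trans (Nat.pow_le_pow_right (by norm_num) ((by omega : 3 * e + 3 ≤ 3 * e + 8).trans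
    (Summit.ValiantsHypothesis.ValiantsHypothesis.Cruxes.WordLengthQP.EpsOrderLadder.exp_bound_word_to_vqp ℓ c)))

/-- **The crux** `LacunarySymmetroid.PencilTransfer` (stmt-ValiantsHypothesis-18051), along line
`real-descent-exact`: descent of the hypothesis to `ℝ` (Hrubeš–Yehudayoff), `VP ⇒ dc` qp over
`ℝ`, GKKP symmetrisation over `ℝ`, restriction to the monomial curve as a polynomial identity. -/
theorem pencilTransfer_proof :
    Summit.ValiantsHypothesis.ValiantsHypothesis.Theses.LacunarySymmetroid.PencilTransfer := by
  intro v f hf d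
  obtain ⟨⟨c₀, hc₀⟩, hrep⟩ := symmAffineRepr_of_isVPFamily_complex v f hf
  refine ⟨c₀ + 11, fun n => ?_⟩
  obtain ⟨B, hsymm, hB⟩ := hrep n
  obtain ⟨S, hS, hroots⟩ := pencilTransfer_pointwise (f n) B hsymm hB (d n)
  exact ⟨4 * determinantalComplexity (f n) ^ 3 + 7, pencilTransfer_size_bound (hc₀ n), S, hS, hroots⟩

end Summit.ValiantsHypothesis.ValiantsHypothesis.Theorems.LacunarySymmetroid

end
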